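import Mathlib
import HarnessLib
import Summits.HubbardSuperconductivity.HubbardSuperconductivity.Theorems.KLProgrammeC4aPartnerBandCooperDefectTwo
import Summits.HubbardSuperconductivity.HubbardSuperconductivity.Theorems.KLProgrammeC4aPartnerBandCritical

/-!
# Route `KLProgramme` — crux C4a, S3 brick (B2, ph twin near FORWARD, orders 0–2): the partner band `e_K(Φ(e,α+t) − D(t))` of the co-moving ph loop along the
# pair-difference path is `e + O(|ρ| + |ϑ|)` with its first two t-derivatives `O(|ρ| + |ϑ|)`, uniformly in the loop variables

Cell `gate-hubbard-kl`, lane hubbard-kl-c4a-1 (g6); helper for stub (C) `stub_twoLeg_curvature` of the engine-flow child `KLRegimeEngineV17F2`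
(stmt-HubbardSuperconductivity-20437); memo HOME/hubbard-kl-c4a-1/C4A-PLAN.md §24.4 (i), §24.6 (B2).  The ph-crossed bubble is read at `D(t) = pairDiffPath μ K ρ ϑ θ t`, rigid at
the forward configuration `(ρ,ϑ) = (0,0)` (`D ≡ 0`; g5's `norm_pairDiffPath_zero_le`, `norm_deriv_pairDiffPath_le_rigid`, `norm_iteratedDeriv_pairDiffPath_le_rigid`); its loop
partner is `Φ(e,α+t) − D(t) = S̃(t) − γ̃(t)` with `S̃ = −D`, `γ̃ = −Φ(e,α+·)`, reference `e_K(−γ̃) = e_K(Φ(e,·)) ≡ e`.  So the Cooper lemmas apply verbatim: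

* §1 `abs_iteratedDeriv_one_comp_sub_le` — the carrier-free ORDER-1 lemma (`|∂_t|₀ f(S(t) − γ(t))| ≤ K₁·s₁ + K₂·s₀·m₁` against `f(−γ) ≡ e`), companion of
  `…CooperDefectTwo.abs_iteratedDeriv_two_comp_sub_le`;
* §2 `abs_partnerBand_ph_sub_le`, `abs_iteratedDeriv_one_partnerBand_ph_le`, `abs_iteratedDeriv_two_partnerBand_ph_le` — orders 0, 1, 2 near forward, every term
  carrying `|ρ|` or `|ϑ|`.

Pure calculus; nothing about the model's sizes; nothing asserts superconductivity.  References: FST II CPAM 51 (1998) §3 Thm 3.5; BGM 2006 §2.4 (2.40) [cite: BenfattoGiulianiMastropietro2006].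
-/

noncomputable section

namespace Summit.HubbardSuperconductivity.HubbardSuperconductivity.Theorems.C4a

set_option linter.dupNamespace false -- summit = problem name (single-conjunct summit), D-0017

open Real Set Filter
open scoped Topology
open Literature.MathematicalPhysics.QuantumLattice Literature.MathematicalPhysics.QuantumLattice.BandSectorCounting Literature.Probability.LatticeModels
open Summit.HubbardSuperconductivity.HubbardSuperconductivity.Theorems.KLRegimeSplit
open Summit.HubbardSuperconductivity.HubbardSuperconductivity.Theorems.DispersionFlow
open Summit.HubbardSuperconductivity.HubbardSuperconductivity.Theorems.PerturbedFermiCurve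

/-! ## §1 The carrier-free first-order lemma -/

section Abstract

variable {V : Type*} [NormedAddCommGroup V] [NormedSpace ℝ V]

/-- **First t-derivative of `f(S(t) − γ(t))` against the rigid reference `f(−γ(t)) ≡ e`**: `≤ K₁·s₁ + K₂·s₀·m₁`. -/
theorem abs_iteratedDeriv_one_comp_sub_le {f : V → ℝ} (hf : ContDiff ℝ 4 f) {K₁ K₂ : ℝ} (hK₁ : ∀ x, ‖fderiv ℝ f x‖ ≤ K₁)
    (hK₂ : ∀ x, ‖iteratedFDeriv ℝ 2 f x‖ ≤ K₂) {S γ : ℝ → V} (hS : ContDiff ℝ 4 S) (hγ : ContDiff ℝ 4 γ)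
    {e : ℝ} (href : ∀ t, f (-γ t) = e) {s₀ s₁ m₁ : ℝ} (hs₀ : ‖S 0‖ ≤ s₀) (hs₁ : ‖iteratedDeriv 1 S 0‖ ≤ s₁) (hm₁ : ‖iteratedDeriv 1 γ 0‖ ≤ m₁) :
    |iteratedDeriv 1 (fun t : ℝ => f (S t - γ t)) 0| ≤ K₁ * s₁ + K₂ * s₀ * m₁ := by
  have hK₁0 : 0 ≤ K₁ := (norm_nonneg _).trans (hK₁ 0)
  have hK₂0 : 0 ≤ K₂ := (norm_nonneg _).trans (hK₂ 0)
  have hs00 : 0 ≤ s₀ := (norm_nonneg _).trans hs₀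
  have hc : ContDiff ℝ 4 (fun t : ℝ => S t - γ t) := hS.sub hγ
  have hn : ContDiff ℝ 4 (fun t : ℝ => -γ t) := hγ.neg
  have h1 := iteratedDeriv_one_comp_eq hf hc 0
  have h2 := iteratedDeriv_one_comp_eq hf hn 0
  have hc1 : iteratedDeriv 1 (fun t : ℝ => S t - γ t) 0 = iteratedDeriv 1 S 0 - iteratedDeriv 1 γ 0 :=
    iteratedDeriv_fun_sub (hS.contDiffAt.of_le (by norm_num)) (hγ.contDiffAt.of_le (by norm_num))
  have hn1 : iteratedDeriv 1 (fun t : ℝ => -γ t) 0 = -iteratedDeriv 1 γ 0 := iteratedDeriv_fun_neg 1 γ 0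
  have href1 : iteratedDeriv 1 (f ∘ fun t : ℝ => -γ t) 0 = 0 := by
    rw [show (f ∘ fun t : ℝ => -γ t) = fun _ => e from funext fun t => href t, iteratedDeriv_const]; simp
  rw [h2, hn1] at href1
  set x := S 0 - γ 0 with hx
  set y := -γ 0 with hy
  set a := iteratedDeriv 1 S 0
  set b := iteratedDeriv 1 γ 0
  have hxy : x - y = S 0 := by rw [hx, hy]; abel
  have hfun : (fun t : ℝ => f (S t - γ t)) = f ∘ fun t : ℝ => S t - γ t := rfl
  rw [hfun, h1, hc1]
  have key : fderiv ℝ f x (a - b) = fderiv ℝ f x a - (fderiv ℝ f x - fderiv ℝ f y) b + fderiv ℝ f y (-b) := by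
    simp only [map_sub, map_neg, show ∀ (P Q : V →L[ℝ] ℝ) (u : V), (P - Q) u = P u - Q u from fun P Q u => rfl]
    ring
  rw [key, href1, add_zero]
  have hLip₁ : ‖fderiv ℝ f x - fderiv ℝ f y‖ ≤ K₂ * ‖S 0‖ := by
    have hdiff : Differentiable ℝ (fderiv ℝ f) := (hf.fderiv_right (m := 3) (by norm_num)).differentiable (by norm_num)
    have h := (convex_univ (𝕜 := ℝ) (E := V)).norm_image_sub_le_of_norm_fderiv_le (𝕜 := ℝ) (f := fderiv ℝ f) (fun z _ => hdiff z)
      (fun z _ => by rw [norm_fderiv_two_eq_norm_iteratedFDeriv]; exact hK₂ z) (mem_univ y) (mem_univ x)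
    rwa [hxy] at h
  have t1 : |fderiv ℝ f x a| ≤ K₁ * s₁ := by
    rw [← Real.norm_eq_abs]; refine ((fderiv ℝ f x).le_opNorm a).trans ?_
    gcongr
    · exact hK₁ x
  have t2 : |(fderiv ℝ f x - fderiv ℝ f y) b| ≤ K₂ * s₀ * m₁ := by
    have hQ : ‖fderiv ℝ f x - fderiv ℝ f y‖ ≤ K₂ * s₀ := hLip₁.trans (mul_le_mul_of_nonneg_left hs₀ hK₂0)
    have hQ0 : 0 ≤ K₂ * s₀ := mul_nonneg hK₂0 hs00
    rw [← Real.norm_eq_abs]; refine ((fderiv ℝ f x - fderiv ℝ f y).le_opNorm b).trans ?_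
    gcongr
  exact (abs_sub _ _).trans (add_le_add t1 t2)

end Abstract

/-! ## §2 The ph loop near the forward configuration -/

section Sizes

variable {K : TrigPolyC4v} {A : ℝ} (hA : ∀ p : Momentum, ∀ j ≤ 2, ‖iteratedFDeriv ℝ j (frameShift K) p‖ ≤ A) (hA20 : A ≤ 1 / 20)
  (hd : klCurveD ≤ (bandBounds (show (-4 : ℝ) < -1.1 by norm_num) (show (-1.1 : ℝ) ≤ -0.1 by norm_num)
    (show (-0.1 : ℝ) < 0 by norm_num)).Dtmin - 2 * A)
  {μ r : ℝ} (hr : 0 < r) (hlo : (-1.1 : ℝ) < μ - r - A) (hhi : μ + r + A < -0.1)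
  {A₃ A₄ : ℝ} (hA₃ : ∀ p : Momentum, ‖iteratedFDeriv ℝ 3 (frameShift K) p‖ ≤ A₃)
  (hA₄ : ∀ p : Momentum, ‖iteratedFDeriv ℝ 4 (frameShift K) p‖ ≤ A₄)
  {K₁ K₂ K₃ : ℝ} (hK₁ : ∀ p : Momentum, ‖fderiv ℝ (frameLevel μ K) p‖ ≤ K₁) (hK₂ : ∀ p : Momentum, ‖iteratedFDeriv ℝ 2 (frameLevel μ K) p‖ ≤ K₂)
  (hK₃ : ∀ p : Momentum, ‖iteratedFDeriv ℝ 3 (frameLevel μ K) p‖ ≤ K₃)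
include hA hA20 hd hr hlo hhi hA₃ hA₄ hK₁ hK₂ hK₃

omit hA hA20 hd hr hlo hhi hA₃ hA₄ hK₁ hK₂ hK₃ in
/-- The ph partner `Φ(e,α+t) − D(t)` is `S̃(t) − γ̃(t)` with `S̃ = −D`, `γ̃ = −Φ(e,α+·)`. -/
theorem partner_ph_eq (e α ρ ϑ θ : ℝ) :
    (fun t : ℝ => frameLevel μ K (levelPoint μ K e (α + t) - pairDiffPath μ K ρ ϑ θ t)) =
      fun t : ℝ => frameLevel μ K ((fun s : ℝ => -pairDiffPath μ K ρ ϑ θ s) t - (fun s : ℝ => -levelPoint μ K e (α + s)) t) := by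
  funext t; simp only [sub_neg_eq_add, neg_add_eq_sub]

omit hK₂ hK₃ in
/-- **ORDER 0 near forward**: `|e_K(Φ(e,α) − D(0)) − e| ≤ K₁·(|ρ|/d + msD₁·|ϑ|)`. -/
theorem abs_partnerBand_ph_sub_le {ρ : ℝ} (hρ : |ρ| < r) {e : ℝ} (he : |e| < r) (ϑ θ α : ℝ) :
    |frameLevel μ K (levelPoint μ K e α - pairDiffPath μ K ρ ϑ θ 0) - e| ≤
      K₁ * (|ρ| / ((bandBounds (show (-4 : ℝ) < -1.1 by norm_num) (show (-1.1 : ℝ) ≤ -0.1 by norm_num) (show (-0.1 : ℝ) < 0 by norm_num)).Dtmin - 2 * A) +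
        msD A₃ A₄ 1 * |ϑ|) := by
  have hK₁0 : 0 ≤ K₁ := (norm_nonneg _).trans (hK₁ 0)
  have h1 := abs_frameLevel_sub_le hK₁ (levelPoint μ K e α - pairDiffPath μ K ρ ϑ θ 0) (levelPoint μ K e α)
  rw [frameLevel_levelPoint_tube (bandBounds (show (-4 : ℝ) < -1.1 by norm_num) (show (-1.1 : ℝ) ≤ -0.1 by norm_num) (show (-0.1 : ℝ) < 0 by norm_num)) hA
      hlo hhi he,
    show levelPoint μ K e α - pairDiffPath μ K ρ ϑ θ 0 - levelPoint μ K e α = -pairDiffPath μ K ρ ϑ θ 0 by abel, norm_neg] at h1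
  exact h1.trans (mul_le_mul_of_nonneg_left (norm_pairDiffPath_zero_le hA hA20 hd hr hlo hhi hA₃ hA₄ hρ ϑ θ) hK₁0)

omit hK₃ in
/-- **ORDER 1 near forward**: `|∂_t|₀ e_K(Φ(e,α+t) − D(t))| ≤ K₁·(RR1·|ρ| + msD₂|ϑ|) + K₂·(|ρ|/d + msD₁|ϑ|)·msD₁`. -/
theorem abs_iteratedDeriv_one_partnerBand_ph_le {ρ : ℝ} (hρ : |ρ| < r) {e : ℝ} (he : |e| < r) (ϑ θ α : ℝ) :
    |iteratedDeriv 1 (fun t : ℝ => frameLevel μ K (levelPoint μ K e (α + t) - pairDiffPath μ K ρ ϑ θ t)) 0| ≤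
      K₁ * (radialRowOneConst A ((bandBounds (show (-4 : ℝ) < -1.1 by norm_num) (show (-1.1 : ℝ) ≤ -0.1 by norm_num) (show (-0.1 : ℝ) < 0 by norm_num)).Dtmin -
          2 * A) * |ρ| + msD A₃ A₄ 2 * |ϑ|) +
        K₂ * (|ρ| / ((bandBounds (show (-4 : ℝ) < -1.1 by norm_num) (show (-1.1 : ℝ) ≤ -0.1 by norm_num) (show (-0.1 : ℝ) < 0 by norm_num)).Dtmin - 2 * A) +
          msD A₃ A₄ 1 * |ϑ|) * msD A₃ A₄ 1 := by
  set B₀ := bandBounds (show (-4 : ℝ) < -1.1 by norm_num) (show (-1.1 : ℝ) ≤ -0.1 by norm_num) (show (-0.1 : ℝ) < 0 by norm_num) with hB₀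
  have hADt : 2 * A < B₀.Dtmin := by have := klCurveD_pos; linarith
  have hS : ContDiff ℝ 4 (fun s : ℝ => -pairDiffPath μ K ρ ϑ θ s) := (contDiff_pairDiffPath B₀ hA hADt hr hlo hhi hρ ϑ θ).neg
  have hγc : ContDiff ℝ 4 (fun s : ℝ => levelPoint μ K e (α + s)) := (contDiff_levelPoint_angle B₀ hA hADt hlo hhi he).comp (contDiff_const.add contDiff_id)
  have hγ : ContDiff ℝ 4 (fun s : ℝ => -levelPoint μ K e (α + s)) := hγc.neg
  have href : ∀ t : ℝ, frameLevel μ K (-(fun s : ℝ => -levelPoint μ K e (α + s)) t) = e := fun t => by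
    simp only [neg_neg]; exact frameLevel_levelPoint_tube B₀ hA hlo hhi he (α + t)
  have hs₀ : ‖(fun s : ℝ => -pairDiffPath μ K ρ ϑ θ s) 0‖ ≤ |ρ| / (B₀.Dtmin - 2 * A) + msD A₃ A₄ 1 * |ϑ| := by
    simp only [norm_neg]; exact norm_pairDiffPath_zero_le hA hA20 hd hr hlo hhi hA₃ hA₄ hρ ϑ θ
  have hs₁ : ‖iteratedDeriv 1 (fun s : ℝ => -pairDiffPath μ K ρ ϑ θ s) 0‖ ≤ radialRowOneConst A (B₀.Dtmin - 2 * A) * |ρ| + msD A₃ A₄ 2 * |ϑ| := by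
    rw [iteratedDeriv_fun_neg, norm_neg]; exact norm_deriv_pairDiffPath_le_rigid hA hA20 hd hr hlo hhi hA₃ hA₄ hρ ϑ θ
  have hm₁ : ‖iteratedDeriv 1 (fun s : ℝ => -levelPoint μ K e (α + s)) 0‖ ≤ msD A₃ A₄ 1 := by
    rw [iteratedDeriv_fun_neg, norm_neg, iteratedDeriv_comp_const_add 1 (levelPoint μ K e) α]
    show ‖iteratedDeriv 1 (levelPoint μ K e) (α + 0)‖ ≤ _
    rw [add_zero]; exact norm_iteratedDeriv_levelPoint_le hA hA20 hd hlo hhi hA₃ hA₄ he (i := 1) le_rfl (by norm_num) α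
  rw [partner_ph_eq]
  exact abs_iteratedDeriv_one_comp_sub_le (EngineV8.contDiff_frameLevel μ K) hK₁ hK₂ hS hγ href hs₀ hs₁ hm₁

/-- **ORDER 2 near forward**: `|∂_t²|₀ e_K(Φ(e,α+t) − D(t))| ≤ K₂(s₁² + 2s₁msD₁) + K₃·s₀·msD₁² + K₁·s₂ + K₂·s₀·msD₂` with `s₀ = |ρ|/d + msD₁|ϑ|`,
`s₁ = RR1·|ρ| + msD₂|ϑ|`, `s₂ = Lrad₂|ρ| + msD₃|ϑ|`. -/
theorem abs_iteratedDeriv_two_partnerBand_ph_le {ρ : ℝ} (hρ : |ρ| < r) {e : ℝ} (he : |e| < r) (ϑ θ α : ℝ) :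
    |iteratedDeriv 2 (fun t : ℝ => frameLevel μ K (levelPoint μ K e (α + t) - pairDiffPath μ K ρ ϑ θ t)) 0| ≤
      K₂ * ((radialRowOneConst A ((bandBounds (show (-4 : ℝ) < -1.1 by norm_num) (show (-1.1 : ℝ) ≤ -0.1 by norm_num) (show (-0.1 : ℝ) < 0 by norm_num)).Dtmin -
            2 * A) * |ρ| + msD A₃ A₄ 2 * |ϑ|) ^ 2 +
          2 * (radialRowOneConst A ((bandBounds (show (-4 : ℝ) < -1.1 by norm_num) (show (-1.1 : ℝ) ≤ -0.1 by norm_num) (show (-0.1 : ℝ) < 0 by norm_num)).Dtmin -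
            2 * A) * |ρ| + msD A₃ A₄ 2 * |ϑ|) * msD A₃ A₄ 1) +
        K₃ * (|ρ| / ((bandBounds (show (-4 : ℝ) < -1.1 by norm_num) (show (-1.1 : ℝ) ≤ -0.1 by norm_num) (show (-0.1 : ℝ) < 0 by norm_num)).Dtmin - 2 * A) +
          msD A₃ A₄ 1 * |ϑ|) * msD A₃ A₄ 1 ^ 2 +
        K₁ * ((uRowTwoConst A A₃ ((bandBounds (show (-4 : ℝ) < -1.1 by norm_num) (show (-1.1 : ℝ) ≤ -0.1 by norm_num) (show (-0.1 : ℝ) < 0 by norm_num)).Dtmin -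
            2 * A) + 1 / ((bandBounds (show (-4 : ℝ) < -1.1 by norm_num) (show (-1.1 : ℝ) ≤ -0.1 by norm_num) (show (-0.1 : ℝ) < 0 by norm_num)).Dtmin - 2 * A) +
            2 * (radialRowOneConst A ((bandBounds (show (-4 : ℝ) < -1.1 by norm_num) (show (-1.1 : ℝ) ≤ -0.1 by norm_num)
              (show (-0.1 : ℝ) < 0 by norm_num)).Dtmin - 2 * A) -
              1 / ((bandBounds (show (-4 : ℝ) < -1.1 by norm_num) (show (-1.1 : ℝ) ≤ -0.1 by norm_num) (show (-0.1 : ℝ) < 0 by norm_num)).Dtmin - 2 * A))) * |ρ| +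
          msD A₃ A₄ 3 * |ϑ|) +
        K₂ * (|ρ| / ((bandBounds (show (-4 : ℝ) < -1.1 by norm_num) (show (-1.1 : ℝ) ≤ -0.1 by norm_num) (show (-0.1 : ℝ) < 0 by norm_num)).Dtmin - 2 * A) +
          msD A₃ A₄ 1 * |ϑ|) * msD A₃ A₄ 2 := by
  set B₀ := bandBounds (show (-4 : ℝ) < -1.1 by norm_num) (show (-1.1 : ℝ) ≤ -0.1 by norm_num) (show (-0.1 : ℝ) < 0 by norm_num) with hB₀
  have hADt : 2 * A < B₀.Dtmin := by have := klCurveD_pos; linarith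
  have hS : ContDiff ℝ 4 (fun s : ℝ => -pairDiffPath μ K ρ ϑ θ s) := (contDiff_pairDiffPath B₀ hA hADt hr hlo hhi hρ ϑ θ).neg
  have hγc : ContDiff ℝ 4 (fun s : ℝ => levelPoint μ K e (α + s)) := (contDiff_levelPoint_angle B₀ hA hADt hlo hhi he).comp (contDiff_const.add contDiff_id)
  have hγ : ContDiff ℝ 4 (fun s : ℝ => -levelPoint μ K e (α + s)) := hγc.neg
  have href : ∀ t : ℝ, frameLevel μ K (-(fun s : ℝ => -levelPoint μ K e (α + s)) t) = e := fun t => by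
    simp only [neg_neg]; exact frameLevel_levelPoint_tube B₀ hA hlo hhi he (α + t)
  have hs₀ : ‖(fun s : ℝ => -pairDiffPath μ K ρ ϑ θ s) 0‖ ≤ |ρ| / (B₀.Dtmin - 2 * A) + msD A₃ A₄ 1 * |ϑ| := by
    simp only [norm_neg]; exact norm_pairDiffPath_zero_le hA hA20 hd hr hlo hhi hA₃ hA₄ hρ ϑ θ
  have hs₁ : ‖iteratedDeriv 1 (fun s : ℝ => -pairDiffPath μ K ρ ϑ θ s) 0‖ ≤ radialRowOneConst A (B₀.Dtmin - 2 * A) * |ρ| + msD A₃ A₄ 2 * |ϑ| := by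
    rw [iteratedDeriv_fun_neg, norm_neg]; exact norm_deriv_pairDiffPath_le_rigid hA hA20 hd hr hlo hhi hA₃ hA₄ hρ ϑ θ
  have hs₂ : ‖iteratedDeriv 2 (fun s : ℝ => -pairDiffPath μ K ρ ϑ θ s) 0‖ ≤
      (uRowTwoConst A A₃ (B₀.Dtmin - 2 * A) + 1 / (B₀.Dtmin - 2 * A) + 2 * (radialRowOneConst A (B₀.Dtmin - 2 * A) - 1 / (B₀.Dtmin - 2 * A))) * |ρ| +
        msD A₃ A₄ 3 * |ϑ| := by
    rw [iteratedDeriv_fun_neg, norm_neg]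
    exact norm_iteratedDeriv_pairDiffPath_le_rigid hA hA20 hd hr hlo hhi hA₃ hA₄ hρ (i := 2) (by norm_num)
      (fun s => norm_iteratedDeriv_two_levelPoint_sub_le hA hA20 hd hr hlo hhi hA₃ hA₄ hρ s) ϑ θ
  have hm₁ : ‖iteratedDeriv 1 (fun s : ℝ => -levelPoint μ K e (α + s)) 0‖ ≤ msD A₃ A₄ 1 := by
    rw [iteratedDeriv_fun_neg, norm_neg, iteratedDeriv_comp_const_add 1 (levelPoint μ K e) α]
    show ‖iteratedDeriv 1 (levelPoint μ K e) (α + 0)‖ ≤ _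
    rw [add_zero]; exact norm_iteratedDeriv_levelPoint_le hA hA20 hd hlo hhi hA₃ hA₄ he (i := 1) le_rfl (by norm_num) α
  have hm₂ : ‖iteratedDeriv 2 (fun s : ℝ => -levelPoint μ K e (α + s)) 0‖ ≤ msD A₃ A₄ 2 := by
    rw [iteratedDeriv_fun_neg, norm_neg, iteratedDeriv_comp_const_add 2 (levelPoint μ K e) α]
    show ‖iteratedDeriv 2 (levelPoint μ K e) (α + 0)‖ ≤ _
    rw [add_zero]; exact norm_iteratedDeriv_levelPoint_le hA hA20 hd hlo hhi hA₃ hA₄ he (i := 2) (by norm_num) (by norm_num) α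
  rw [partner_ph_eq]
  exact abs_iteratedDeriv_two_comp_sub_le (EngineV8.contDiff_frameLevel μ K) hK₁ hK₂ hK₃ hS hγ href hs₀ hs₁ hs₂ hm₁ hm₂

end Sizes

end Summit.HubbardSuperconductivity.HubbardSuperconductivity.Theorems.C4a

end
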